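import Literature.MathematicalPhysics.QuantumChemistry.SlaterCondonRulesStrings
import HarnessLib

/-!
# The Slater–Condon rules, III: ON vectors differing in one pair — (1.4.6), (1.4.21)

Part III of the Slater–Condon rules of Helgaker–Jørgensen–Olsen (2000) §1.4.1–1.4.2 on the tree's
Jordan–Wigner Fock space (setting: `SlaterCondonRules.lean`; strings: `SlaterCondonRulesStrings.lean`).
One replacement: `|k₁⟩ = |J⟩`, `b ∈ J` occupied (HJO's `J`), `a ∉ J` empty (HJO's `I`),
`|k₂⟩ = |J ∖ b ∪ a⟩`, `a†_a a_b |k₁⟩ = Γ_b^{k₁} Γ_a^{k₁∖b} |k₂⟩ = Γ_I^{k₂} Γ_J^{k₁} |k₂⟩`: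

* `dGamma_apply_single` / `dGamma_apply_single'` — **(1.4.6)** `⟨k₂|f̂|k₁⟩ = Γ_I^{k₂} Γ_J^{k₁} f_IJ`;
* `twoElectronOp_apply_single_general` — the four sums of (1.4.35), no symmetry assumed on `g`;
* `twoElectronOp_apply_single` / `twoElectronOp_apply_single'` — **(1.4.21)**
  `⟨k₂|ĝ|k₁⟩ = Γ_I^{k₂} Γ_J^{k₁} Σ_R k_R (g_IJRR − g_IRRJ)` under `g_PQRS = g_RSPQ` (1.4.17).

Method (HJO's): transfer `⟨k₂|X|k₁⟩ = ± ⟨k₁| W† X |k₁⟩` along the string `W = a†_a a_b`, move `a_a` to the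
right with (1.2.29) until it meets `|k₁⟩`, which it kills, and read off occupation numbers with the
diagonal rules of part I. Two replacements ((1.4.7), (1.4.24)) are in `SlaterCondonRulesDouble.lean`.
Everything is PROVED (0 sorry); no definition, no named fact; helpers are `private`.

## References

* T. Helgaker, P. Jørgensen, J. Olsen, *Molecular Electronic-Structure Theory*, Wiley (2000), §1.2
  eqs. (1.2.3), (1.2.5), (1.2.16), (1.2.22), (1.2.29); §1.3.1 eq. (1.3.2); §1.4.1 eqs. (1.4.2)–(1.4.13);
  §1.4.2 eqs. (1.4.14)–(1.4.38); §1.4.3 eq. (1.4.39); held copy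
  `book:helgakernd-molecular-electronic-structure-theory` (chunks p0039–p0042, p0045–p0049 read
  2026-08-21). [cite: HelgakerJorgensenOlsen2000, §1.4.1–1.4.2]
* J. C. Slater, Phys. Rev. 34 (1929) 1293; E. U. Condon, Phys. Rev. 36 (1930) 1121 (the original
  rules; ref. [1] of HJO Ch. 1).
-/

noncomputable section

namespace Literature.MathematicalPhysics.QuantumChemistry

open Matrix Finset
open Literature.MathematicalPhysics.QuantumLattice

section SpinOrbital

variable {ι : Type*} [LinearOrder ι] [Fintype ι]

/-- `X_{IJ} = (X |J⟩)_I` for the ON vector `|J⟩ = e_J` (plumbing). [folklore] -/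
private theorem apply_eq_mulVec_single (X : Matrix (Finset ι) (Finset ι) ℂ) (I J : Finset ι) :
    X I J = (X *ᵥ Pi.single J (1 : ℂ)) I := by
  rw [mulVec_single_one, col_apply]

/-- **Transfer of a transition element to a diagonal one** (helper). If a string `W` of elementary
operators maps `|J⟩` to `s |I⟩` with a real sign `s` (`s̄ = s`, `s² = 1`), then
`⟨I| X |J⟩ = s ⟨J| W† X |J⟩` for every operator `X` (since `⟨I| = s ⟨J| W†`); this is how
Helgaker–Jørgensen–Olsen evaluate (1.4.10) and (1.4.32)–(1.4.36). [folklore] -/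
private theorem apply_eq_sign_mul_conjTranspose_mul_apply {W X : Matrix (Finset ι) (Finset ι) ℂ}
    {I J : Finset ι} {s : ℂ} (hW : W *ᵥ Pi.single J (1 : ℂ) = s • Pi.single I 1)
    (hs : star s = s) (hs1 : s * s = 1) :
    X I J = s * (Wᴴ * X) J J := by
  have hWK : ∀ K, W K J = s * (Pi.single I (1 : ℂ) : Fock ι) K := fun K => by
    rw [apply_eq_mulVec_single W K J, hW, Pi.smul_apply, smul_eq_mul]
  have hK : ∀ K, star (W K J) * X K J = if I = K then s * X K J else 0 := by
    intro K
    rw [hWK, star_mul', hs]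
    by_cases hKI : I = K
    · subst hKI
      rw [Pi.single_eq_same, star_one, mul_one, if_pos rfl]
    · rw [Pi.single_eq_of_ne' hKI, star_zero, mul_zero, zero_mul, if_neg hKI]
  rw [Matrix.mul_apply]
  simp_rw [conjTranspose_apply, hK, Finset.sum_ite_eq, Finset.mem_univ, if_true, ← mul_assoc, hs1,
    one_mul]

/-! ### One replacement: (1.4.6), (1.4.21) -/

section Single

variable {a b : ι} {J : Finset ι}

omit [Fintype ι] in
/-- The single-replacement phase is real (helper). [folklore] -/
private theorem star_singleSign (a b : ι) (J : Finset ι) :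
    star (jwSign b J * jwSign a (J.erase b)) = jwSign b J * jwSign a (J.erase b) := by
  rw [star_mul', star_jwSign, star_jwSign]

omit [Fintype ι] in
/-- The single-replacement phase squares to one (helper). [folklore] -/
private theorem singleSign_mul_self (a b : ι) (J : Finset ι) :
    jwSign b J * jwSign a (J.erase b) * (jwSign b J * jwSign a (J.erase b)) = 1 := by
  rw [mul_mul_mul_comm, jwSign_mul_self, jwSign_mul_self, mul_one]

/-- **One-electron operator, ON vectors differing in one pair** — Helgaker–Jørgensen–Olsen (2000)
eq. (1.4.6): if `|k₂⟩` is obtained from `|k₁⟩ = |J⟩` by emptying the occupied spin orbital `b`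
(HJO's `J`) and filling the empty spin orbital `a` (HJO's `I`), then
`⟨k₂| f̂ |k₁⟩ = Γ_I^{k₂} Γ_J^{k₁} f_{IJ}`; here the phase is written as met by the string
`a†_a a_b`, `Γ_b^{J} Γ_a^{J∖b}` (`= Γ_I^{k₂} Γ_J^{k₁}`, see `dGamma_apply_single'`).
[cite: HelgakerJorgensenOlsen2000, eq. (1.4.6)] -/
theorem dGamma_apply_single (f : Matrix ι ι ℂ) (hb : b ∈ J) (ha : a ∉ J) :
    dGamma f (insert a (J.erase b)) J = jwSign b J * jwSign a (J.erase b) * f a b := by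
  rw [apply_eq_sign_mul_conjTranspose_mul_apply (X := dGamma f)
    (creation_mul_annihilation_mulVec_single_of_mem hb ha) (star_singleSign a b J)
    (singleSign_mul_self a b J), conjTranspose_creation_mul_annihilation]
  congr 1
  rw [dGamma_eq, Finset.mul_sum]
  simp only [Finset.mul_sum, Matrix.mul_smul, Matrix.sum_apply, Matrix.smul_apply, smul_eq_mul,
    single_oneString_apply hb ha, mul_ite, mul_one, mul_zero, Finset.sum_ite_irrel,
    Finset.sum_const_zero, Finset.sum_ite_eq, Finset.mem_univ, if_true]

/-- (1.4.6) with the phase in Helgaker–Jørgensen–Olsen's form `Γ_I^{k₂} Γ_J^{k₁}`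
(`Γ_P^{k} = jwSign P k`, eq. (1.2.3)). [cite: HelgakerJorgensenOlsen2000, eq. (1.4.6)] -/
theorem dGamma_apply_single' (f : Matrix ι ι ℂ) (hb : b ∈ J) (ha : a ∉ J) :
    dGamma f (insert a (J.erase b)) J =
      jwSign a (insert a (J.erase b)) * jwSign b J * f a b := by
  rw [dGamma_apply_single f hb ha, jwSign_insert_of_not_lt (lt_irrefl a), mul_comm (jwSign b J)]

/-- **Two-electron operator, ON vectors differing in one pair, general integrals**: with `|k₂⟩`,
`|k₁⟩ = |J⟩`, `a`, `b` as in `dGamma_apply_single` and NO permutational symmetry assumed on `g`,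
`⟨k₂| ĝ |k₁⟩ = Γ · ½ Σ_{R ∈ J} ((g_{abRR} + g_{RRab}) − (g_{aRRb} + g_{RbaR}))` — the four sums of
Helgaker–Jørgensen–Olsen (2000) eq. (1.4.35). [cite: HelgakerJorgensenOlsen2000, eq. (1.4.35)] -/
theorem twoElectronOp_apply_single_general (g : ι → ι → ι → ι → ℂ) (hb : b ∈ J) (ha : a ∉ J) :
    twoElectronOp g (insert a (J.erase b)) J =
      jwSign b J * jwSign a (J.erase b) *
        ((1 / 2 : ℂ) * ∑ R ∈ J, ((g a b R R + g R R a b) - (g a R R b + g R b a R))) := by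
  rw [apply_eq_sign_mul_conjTranspose_mul_apply (X := twoElectronOp g)
    (creation_mul_annihilation_mulVec_single_of_mem hb ha) (star_singleSign a b J)
    (singleSign_mul_self a b J), conjTranspose_creation_mul_annihilation]
  congr 1
  rw [twoElectronOp, Matrix.mul_smul, Matrix.smul_apply, smul_eq_mul]
  congr 1
  rw [show (creation b * annihilation a * ∑ P, ∑ Q, ∑ R, ∑ S,
      g P Q R S • (creation P * creation R * annihilation S * annihilation Q)) J J =
      ∑ P, ∑ Q, ∑ R, ∑ S, g P Q R S *
        (creation b * annihilation a * (creation P * creation R * annihilation S * annihilation Q)) J J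
      by simp only [Finset.mul_sum, Matrix.mul_smul, Matrix.sum_apply, Matrix.smul_apply, smul_eq_mul]]
  have hsplit : ∑ P, ∑ Q, ∑ R, ∑ S, g P Q R S *
      (creation b * annihilation a * (creation P * creation R * annihilation S * annihilation Q)) J J =
      (∑ P, ∑ Q, ∑ R, ∑ S, g P Q R S * ((if a = P then (1 : ℂ) else 0) *
        (creation b * creation R * annihilation S * annihilation Q) J J)) -
      ∑ P, ∑ Q, ∑ R, ∑ S, g P Q R S * ((if a = R then (1 : ℂ) else 0) *
        (creation b * creation P * annihilation S * annihilation Q) J J) := by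
    simp only [single_twoString_apply ha, mul_sub, Finset.sum_sub_distrib]
  -- first group: `P = a`
  have h1 : ∑ P, ∑ Q, ∑ R, ∑ S, g P Q R S * ((if a = P then (1 : ℂ) else 0) *
      (creation b * creation R * annihilation S * annihilation Q) J J) =
      ∑ R ∈ J, (g a b R R - g a R R b) := by
    simp only [boole_mul, mul_ite, mul_zero, Finset.sum_ite_irrel, Finset.sum_const_zero,
      Finset.sum_ite_eq, Finset.mem_univ, if_true]
    exact sum_mul_twoElectronString_apply_self (fun Q R S => g a Q R S) hb
  -- second group: `R = a`
  have h2 : ∑ P, ∑ Q, ∑ R, ∑ S, g P Q R S * ((if a = R then (1 : ℂ) else 0) *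
      (creation b * creation P * annihilation S * annihilation Q) J J) =
      ∑ R ∈ J, (g R b a R - g R R a b) := by
    simp only [boole_mul, mul_ite, mul_zero, Finset.sum_ite_irrel, Finset.sum_const_zero,
      Finset.sum_ite_eq, Finset.mem_univ, if_true]
    -- now `Σ_P Σ_Q Σ_S g P Q a S ⟨J|a†_b a†_P a_S a_Q|J⟩`; bring `Q` outermost
    rw [Finset.sum_comm]
    rw [sum_mul_twoElectronString_apply_self (fun Q P S => g P Q a S) hb]
  rw [hsplit, h1, h2, ← Finset.sum_sub_distrib]
  refine Finset.sum_congr rfl fun R _ => ?_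
  ring

/-- **Two-electron operator, ON vectors differing in one pair** — Helgaker–Jørgensen–Olsen (2000)
eq. (1.4.21): under the permutational symmetry `g_{PQRS} = g_{RSPQ}` (1.4.17),
`⟨k₂| ĝ |k₁⟩ = Γ_I^{k₂} Γ_J^{k₁} Σ_R k_R (g_{IJRR} − g_{IRRJ})` (sum over the spin orbitals `R`
occupied in `|k₁⟩`; the term `R = J` cancels). [cite: HelgakerJorgensenOlsen2000, eq. (1.4.21)] -/
theorem twoElectronOp_apply_single (g : ι → ι → ι → ι → ℂ) (hg : ∀ P Q R S, g P Q R S = g R S P Q)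
    (hb : b ∈ J) (ha : a ∉ J) :
    twoElectronOp g (insert a (J.erase b)) J =
      jwSign b J * jwSign a (J.erase b) * ∑ R ∈ J, (g a b R R - g a R R b) := by
  rw [twoElectronOp_apply_single_general g hb ha, Finset.mul_sum]
  congr 1
  refine Finset.sum_congr rfl fun R _ => ?_
  rw [← hg a b R R, hg R b a R]
  ring

/-- (1.4.21) with the phase in Helgaker–Jørgensen–Olsen's form `Γ_I^{k₂} Γ_J^{k₁}`.
[cite: HelgakerJorgensenOlsen2000, eq. (1.4.21)] -/
theorem twoElectronOp_apply_single' (g : ι → ι → ι → ι → ℂ) (hg : ∀ P Q R S, g P Q R S = g R S P Q)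
    (hb : b ∈ J) (ha : a ∉ J) :
    twoElectronOp g (insert a (J.erase b)) J =
      jwSign a (insert a (J.erase b)) * jwSign b J * ∑ R ∈ J, (g a b R R - g a R R b) := by
  rw [twoElectronOp_apply_single g hg hb ha, jwSign_insert_of_not_lt (lt_irrefl a),
    mul_comm (jwSign b J)]

end Single

end SpinOrbital

end Literature.MathematicalPhysics.QuantumChemistry
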